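import Literature.Analysis.FluidPDE.TorusWordSpaceTime
import Literature.Analysis.FluidPDE.CompressibleEulerLinearizedDerivative
import Literature.Analysis.FunctionSpaces.TorusClassicalNSGluing
import Literature.Analysis.FunctionSpaces.SpaceTimeSliceDerivatives
import HarnessLib

/-!
# Stub `stub_liftBounds` of the line `SketchIdeator2` (card `separatrix-flux-pinning`), part A:
# iterated one-sided time derivatives on `[0, ∞) × T³`
# (crux stmt-AnomalousDissipation-14249, `MarginalStabilityChain.ChainRealisation`)

Calculus of the iterated one-sided time derivative `(Torus.timeDerivWithin (Ici 0))^[j]` of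
jointly smooth fields on `[0, ∞) × T³` (Foias–Manley–Rosa–Temam 2001, Ch. II §A.5: bounds on
`∂ₜʲ u` are obtained by differentiating the Navier–Stokes equations `j` times in time), the
bookkeeping behind the stub `stub_liftBounds`:

* congruence on the time set, commutation of `∂ₜʲ` with continuous linear maps of the values
  and with finite sums (`liftB_Titer_clm`, `liftB_Titer_finset_sum`);
* `∂ₜ∂ᵢ = ∂ᵢ∂ₜ`, `∂ₜΔ = Δ∂ₜ`, `∂ₜ∇ = ∇∂ₜ` on `Ici 0` (from the tree's slab versions
  `Torus.timeDerivWithin_partialDeriv_comm`, `Torus.timeDerivWithin_laplacian_comm` on `Icc 0 b`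
  and `Torus.IsSmoothSpaceTimeOn.timeDerivWithin_eq_of_subset`), iterated and along words
  (`liftB_Titer_wordDeriv_comm`);
* the Leibniz rule for `∂ₜ` of the convective derivative `(a·∇)b` (`liftB_T_convect`);
* incompressibility is inherited by `∂ₜʲ u` and by all word derivatives
  (`liftB_Titer_isDivFree`, `liftB_isDivFree_wordDeriv`).

References: C. Foias, O. Manley, R. Rosa, R. Temam, *Navier–Stokes Equations and Turbulence*,
CUP 2001, Ch. II App. A §A.5; P. Constantin, C. Foias, *Navier–Stokes Equations*, Univ. Chicago
Press 1988, Ch. 13.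
-/

-- `Summit.<Summit>.<Problem>` is the tree's mandated summit-side namespace (CONVENTIONS §2); for this
-- single-conjunct summit the two coincide, so the duplicate is deliberate.
set_option linter.dupNamespace false

noncomputable section

open MeasureTheory Set Filter Topology Function
open scoped InnerProductSpace
open Literature.Analysis.FunctionSpaces Literature.Analysis.FunctionSpaces.Torus
open Literature.Analysis.FluidPDE.Torus

namespace Summit.AnomalousDissipation.AnomalousDissipation.Theorems.ChainRealisation.SeparatrixFluxPinning

variable {F : Type*} [NormedAddCommGroup F] [NormedSpace ℝ F]
variable {G : Type*} [NormedAddCommGroup G] [NormedSpace ℝ G]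

/-! ## Congruence on the time set and linearity of the iterated time derivative -/

/-- The one-sided time derivative within `S` at `t ∈ S` only depends on the field on `S`. -/
theorem liftB_T_congr {S : Set ℝ} {V₁ V₂ : ℝ → UnitAddTorus (Fin 3) → F}
    (h : ∀ s ∈ S, ∀ x, V₁ s x = V₂ s x) {t : ℝ} (ht : t ∈ S) (x : UnitAddTorus (Fin 3)) :
    timeDerivWithin S V₁ t x = timeDerivWithin S V₂ t x :=
  derivWithin_congr (fun s hs => h s hs x) (h t ht x)

/-- The iterated one-sided time derivative within `S` on `S` only depends on the field on `S`. -/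
theorem liftB_Titer_congr {S : Set ℝ} {V₁ V₂ : ℝ → UnitAddTorus (Fin 3) → F}
    (h : ∀ s ∈ S, ∀ x, V₁ s x = V₂ s x) :
    ∀ (j : ℕ) {t : ℝ}, t ∈ S → ∀ x : UnitAddTorus (Fin 3),
      (timeDerivWithin S)^[j] V₁ t x = (timeDerivWithin S)^[j] V₂ t x
  | 0, _, ht, x => h _ ht x
  | j + 1, t, ht, x => by
      rw [iterate_succ_apply', iterate_succ_apply']
      exact liftB_T_congr (fun s hs y => liftB_Titer_congr h j hs y) ht x

/-- `∂ₜʲ (L ∘ U) = L ∘ ∂ₜʲ U` on `S` for a continuous linear map `L` of the values. -/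
theorem liftB_Titer_clm {S : Set ℝ} (hS : UniqueDiffOn ℝ S) {U : ℝ → UnitAddTorus (Fin 3) → F}
    (hU : IsSmoothSpaceTimeOn S U) (L : F →L[ℝ] G) :
    ∀ (j : ℕ) {t : ℝ}, t ∈ S → ∀ x : UnitAddTorus (Fin 3),
      (timeDerivWithin S)^[j] (fun s y => L (U s y)) t x = L ((timeDerivWithin S)^[j] U t x)
  | 0, _, _, _ => rfl
  | j + 1, t, ht, x => by
      rw [iterate_succ_apply', iterate_succ_apply']
      have ih : ∀ s ∈ S, ∀ y : UnitAddTorus (Fin 3), (timeDerivWithin S)^[j] (fun s y => L (U s y)) s y =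
          (fun s y => L ((timeDerivWithin S)^[j] U s y)) s y :=
        fun s hs y => liftB_Titer_clm hS hU L j hs y
      rw [liftB_T_congr ih ht x]
      exact timeDerivWithin_clm_comp (hU.iterate_timeDerivWithin hS j) hS L ht x

/-- `∂ₜʲ (∑ᵢ Vᵢ) = ∑ᵢ ∂ₜʲ Vᵢ` on `S` for jointly smooth fields. -/
theorem liftB_Titer_finset_sum {S : Set ℝ} (hS : UniqueDiffOn ℝ S) {ι : Type*} (s : Finset ι)
    {V : ι → ℝ → UnitAddTorus (Fin 3) → F} (hV : ∀ i ∈ s, IsSmoothSpaceTimeOn S (V i)) :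
    ∀ (j : ℕ) {t : ℝ}, t ∈ S → ∀ x : UnitAddTorus (Fin 3),
      (timeDerivWithin S)^[j] (fun τ y => ∑ i ∈ s, V i τ y) t x =
        ∑ i ∈ s, (timeDerivWithin S)^[j] (V i) t x
  | 0, _, _, _ => rfl
  | j + 1, t, ht, x => by
      simp only [iterate_succ_apply']
      have ih : ∀ τ ∈ S, ∀ y : UnitAddTorus (Fin 3), (timeDerivWithin S)^[j] (fun τ y => ∑ i ∈ s, V i τ y) τ y =
          (fun τ y => ∑ i ∈ s, (timeDerivWithin S)^[j] (V i) τ y) τ y :=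
        fun τ hτ y => liftB_Titer_finset_sum hS s hV j hτ y
      rw [liftB_T_congr ih ht x]
      exact timeDerivWithin_finset_sum s (fun i hi => (hV i hi).iterate_timeDerivWithin hS j) hS ht x

/-- `∂ₜʲ (U + V) = ∂ₜʲ U + ∂ₜʲ V` on `S` for jointly smooth fields. -/
theorem liftB_Titer_add {S : Set ℝ} (hS : UniqueDiffOn ℝ S) {U V : ℝ → UnitAddTorus (Fin 3) → F}
    (hU : IsSmoothSpaceTimeOn S U) (hV : IsSmoothSpaceTimeOn S V) :
    ∀ (j : ℕ) {t : ℝ}, t ∈ S → ∀ x : UnitAddTorus (Fin 3),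
      (timeDerivWithin S)^[j] (fun s y => U s y + V s y) t x =
        (timeDerivWithin S)^[j] U t x + (timeDerivWithin S)^[j] V t x
  | 0, _, _, _ => rfl
  | j + 1, t, ht, x => by
      simp only [iterate_succ_apply']
      have ih : ∀ τ ∈ S, ∀ y : UnitAddTorus (Fin 3), (timeDerivWithin S)^[j] (fun s y => U s y + V s y) τ y =
          (fun τ y => (timeDerivWithin S)^[j] U τ y + (timeDerivWithin S)^[j] V τ y) τ y :=
        fun τ hτ y => liftB_Titer_add hS hU hV j hτ y
      rw [liftB_T_congr ih ht x]
      exact timeDerivWithin_add (hU.iterate_timeDerivWithin hS j) (hV.iterate_timeDerivWithin hS j)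
        hS ht x

/-- The one-sided time derivative of a difference of jointly smooth fields. -/
theorem liftB_T_sub {S : Set ℝ} (hS : UniqueDiffOn ℝ S) {U V : ℝ → UnitAddTorus (Fin 3) → F}
    (hU : IsSmoothSpaceTimeOn S U) (hV : IsSmoothSpaceTimeOn S V) {t : ℝ} (ht : t ∈ S) (x : UnitAddTorus (Fin 3)) :
    timeDerivWithin S (fun s y => U s y - V s y) t x =
      timeDerivWithin S U t x - timeDerivWithin S V t x := by
  unfold timeDerivWithin
  exact ((hU.hasDerivWithinAt_slice ht x).sub (hV.hasDerivWithinAt_slice ht x)).derivWithin (hS t ht)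

/-- The Leibniz rule for the one-sided time derivative of a scalar multiple. -/
theorem liftB_T_smul {S : Set ℝ} (hS : UniqueDiffOn ℝ S) {a : ℝ → UnitAddTorus (Fin 3) → ℝ} {b : ℝ → UnitAddTorus (Fin 3) → F}
    (ha : IsSmoothSpaceTimeOn S a) (hb : IsSmoothSpaceTimeOn S b) {t : ℝ} (ht : t ∈ S) (x : UnitAddTorus (Fin 3)) :
    timeDerivWithin S (fun s y => a s y • b s y) t x =
      a t x • timeDerivWithin S b t x + timeDerivWithin S a t x • b t x := by
  unfold timeDerivWithin
  exact ((ha.hasDerivWithinAt_slice ht x).smul (hb.hasDerivWithinAt_slice ht x)).derivWithin (hS t ht)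

/-- Time-independent fields have vanishing time derivative. -/
theorem liftB_T_const_field (S : Set ℝ) (g : UnitAddTorus (Fin 3) → F) (t : ℝ) (x : UnitAddTorus (Fin 3)) :
    timeDerivWithin S (fun _ : ℝ => g) t x = 0 := by
  simp [timeDerivWithin]

/-! ## `∂ₜ` commutes with space derivatives on `[0, ∞)` -/

/-- `∂ₜ∂ᵢ = ∂ᵢ∂ₜ` for jointly smooth fields on `[0, ∞) × T³` (one-sided at `t = 0`). -/
theorem liftB_T_partialDeriv_comm {U : ℝ → UnitAddTorus (Fin 3) → F} (hU : IsSmoothSpaceTimeOn (Ici 0) U)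
    {t : ℝ} (ht : t ∈ Ici (0 : ℝ)) (i : Fin 3) (x : UnitAddTorus (Fin 3)) :
    timeDerivWithin (Ici 0) (fun s => partialDeriv i (U s)) t x =
      partialDeriv i (timeDerivWithin (Ici 0) U t) x := by
  have ht0 : 0 ≤ t := ht
  have hb : (0 : ℝ) < t + 1 := by linarith
  have hsub : Icc 0 (t + 1) ⊆ Ici (0 : ℝ) := Icc_subset_Ici_self
  have ht' : t ∈ Icc 0 (t + 1) := ⟨ht0, by linarith⟩
  rw [← (hU.partialDeriv (uniqueDiffOn_Ici 0) i).timeDerivWithin_eq_of_subset hsub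
      (uniqueDiffOn_Icc hb) ht' x,
    timeDerivWithin_partialDeriv_comm hb (hU.mono hsub) ht' i x]
  congr 1
  funext y
  exact hU.timeDerivWithin_eq_of_subset hsub (uniqueDiffOn_Icc hb) ht' y

/-- `∂ₜΔ = Δ∂ₜ` for jointly smooth fields on `[0, ∞) × T³`. -/
theorem liftB_T_laplacian_comm {U : ℝ → UnitAddTorus (Fin 3) → F} (hU : IsSmoothSpaceTimeOn (Ici 0) U)
    {t : ℝ} (ht : t ∈ Ici (0 : ℝ)) (x : UnitAddTorus (Fin 3)) :
    timeDerivWithin (Ici 0) (fun s => laplacian (U s)) t x =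
      laplacian (timeDerivWithin (Ici 0) U t) x := by
  have ht0 : 0 ≤ t := ht
  have hb : (0 : ℝ) < t + 1 := by linarith
  have hsub : Icc 0 (t + 1) ⊆ Ici (0 : ℝ) := Icc_subset_Ici_self
  have ht' : t ∈ Icc 0 (t + 1) := ⟨ht0, by linarith⟩
  rw [← (hU.laplacian (uniqueDiffOn_Ici 0)).timeDerivWithin_eq_of_subset hsub
      (uniqueDiffOn_Icc hb) ht' x,
    timeDerivWithin_laplacian_comm hb (hU.mono hsub) ht' x]
  congr 1
  funext y
  exact hU.timeDerivWithin_eq_of_subset hsub (uniqueDiffOn_Icc hb) ht' y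

/-- `∂ₜʲ∂ᵢ = ∂ᵢ∂ₜʲ` on `[0, ∞) × T³`. -/
theorem liftB_Titer_partialDeriv_comm {U : ℝ → UnitAddTorus (Fin 3) → F} (hU : IsSmoothSpaceTimeOn (Ici 0) U)
    (i : Fin 3) :
    ∀ (j : ℕ) {t : ℝ}, t ∈ Ici (0 : ℝ) → ∀ x : UnitAddTorus (Fin 3),
      (timeDerivWithin (Ici 0))^[j] (fun s => partialDeriv i (U s)) t x =
        partialDeriv i ((timeDerivWithin (Ici 0))^[j] U t) x
  | 0, _, _, _ => rfl
  | j + 1, t, ht, x => by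
      rw [iterate_succ_apply', iterate_succ_apply']
      have ih : ∀ s ∈ Ici (0 : ℝ), ∀ y : UnitAddTorus (Fin 3),
          (timeDerivWithin (Ici 0))^[j] (fun s => partialDeriv i (U s)) s y =
            (fun s => partialDeriv i ((timeDerivWithin (Ici 0))^[j] U s)) s y :=
        fun s hs y => liftB_Titer_partialDeriv_comm hU i j hs y
      rw [liftB_T_congr ih ht x]
      exact liftB_T_partialDeriv_comm (hU.iterate_timeDerivWithin (uniqueDiffOn_Ici 0) j) ht i x

/-- `∂ₜʲ∂^w = ∂^w∂ₜʲ` on `[0, ∞) × T³` for every derivative word `w`. -/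
theorem liftB_Titer_wordDeriv_comm {U : ℝ → UnitAddTorus (Fin 3) → F} (hU : IsSmoothSpaceTimeOn (Ici 0) U)
    (j : ℕ) :
    ∀ (w : List (Fin 3)) {t : ℝ}, t ∈ Ici (0 : ℝ) → ∀ x : UnitAddTorus (Fin 3),
      (timeDerivWithin (Ici 0))^[j] (fun s => wordDeriv w (U s)) t x =
        wordDeriv w ((timeDerivWithin (Ici 0))^[j] U t) x
  | [], _, _, _ => rfl
  | i :: w, t, ht, x => by
      have hw : IsSmoothSpaceTimeOn (Ici 0) (fun s => wordDeriv w (U s)) :=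
        isSmoothSpaceTimeOn_wordDeriv hU (uniqueDiffOn_Ici 0) w
      simp only [wordDeriv_cons]
      rw [liftB_Titer_partialDeriv_comm hw i j ht x]
      congr 1
      funext y
      exact liftB_Titer_wordDeriv_comm hU j w ht y

/-- `∂ₜʲΔ = Δ∂ₜʲ` on `[0, ∞) × T³`. -/
theorem liftB_Titer_laplacian_comm {U : ℝ → UnitAddTorus (Fin 3) → F} (hU : IsSmoothSpaceTimeOn (Ici 0) U) :
    ∀ (j : ℕ) {t : ℝ}, t ∈ Ici (0 : ℝ) → ∀ x : UnitAddTorus (Fin 3),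
      (timeDerivWithin (Ici 0))^[j] (fun s => laplacian (U s)) t x =
        laplacian ((timeDerivWithin (Ici 0))^[j] U t) x
  | 0, _, _, _ => rfl
  | j + 1, t, ht, x => by
      rw [iterate_succ_apply', iterate_succ_apply']
      have ih : ∀ s ∈ Ici (0 : ℝ), ∀ y : UnitAddTorus (Fin 3),
          (timeDerivWithin (Ici 0))^[j] (fun s => laplacian (U s)) s y =
            (fun s => laplacian ((timeDerivWithin (Ici 0))^[j] U s)) s y :=
        fun s hs y => liftB_Titer_laplacian_comm hU j hs y
      rw [liftB_T_congr ih ht x]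
      exact liftB_T_laplacian_comm (hU.iterate_timeDerivWithin (uniqueDiffOn_Ici 0) j) ht x

/-- `∂ₜ∇ = ∇∂ₜ` for jointly smooth scalar fields on `[0, ∞) × T³`. -/
theorem liftB_T_gradient_comm {P : ℝ → UnitAddTorus (Fin 3) → ℝ} (hP : IsSmoothSpaceTimeOn (Ici 0) P)
    {t : ℝ} (ht : t ∈ Ici (0 : ℝ)) (x : UnitAddTorus (Fin 3)) :
    timeDerivWithin (Ici 0) (fun s => gradient (P s)) t x =
      gradient (timeDerivWithin (Ici 0) P t) x := by
  have hS := uniqueDiffOn_Ici (0 : ℝ)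
  have e : ∀ s ∈ Ici (0 : ℝ), ∀ y : UnitAddTorus (Fin 3), (fun s => gradient (P s)) s y =
      (fun s y => ∑ i, partialDeriv i (P s) y • EuclideanSpace.single i (1 : ℝ)) s y :=
    fun s hs y => gradient_eq_sum_partialDeriv ((hP.isSmooth_slice hs).isContDiff (by simp)) y
  rw [liftB_T_congr e ht x,
    timeDerivWithin_finset_sum Finset.univ
      (fun i _ => (hP.partialDeriv hS i).smul (isSmoothSpaceTimeOn_const (isSmooth_const _) _)) hS ht x,
    gradient_eq_sum_partialDeriv (((hP.timeDerivWithin hS).isSmooth_slice ht).isContDiff (by simp)) x]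
  refine Finset.sum_congr rfl fun i _ => ?_
  rw [← liftB_T_partialDeriv_comm hP ht i x]
  unfold timeDerivWithin
  exact (((hP.partialDeriv hS i).hasDerivWithinAt_slice ht x).smul_const _).derivWithin (hS t ht)

/-- `∂ₜʲ∇ = ∇∂ₜʲ` on `[0, ∞) × T³`. -/
theorem liftB_Titer_gradient_comm {P : ℝ → UnitAddTorus (Fin 3) → ℝ} (hP : IsSmoothSpaceTimeOn (Ici 0) P) :
    ∀ (j : ℕ) {t : ℝ}, t ∈ Ici (0 : ℝ) → ∀ x : UnitAddTorus (Fin 3),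
      (timeDerivWithin (Ici 0))^[j] (fun s => gradient (P s)) t x =
        gradient ((timeDerivWithin (Ici 0))^[j] P t) x
  | 0, _, _, _ => rfl
  | j + 1, t, ht, x => by
      rw [iterate_succ_apply', iterate_succ_apply']
      have ih : ∀ s ∈ Ici (0 : ℝ), ∀ y : UnitAddTorus (Fin 3),
          (timeDerivWithin (Ici 0))^[j] (fun s => gradient (P s)) s y =
            (fun s => gradient ((timeDerivWithin (Ici 0))^[j] P s)) s y :=
        fun s hs y => liftB_Titer_gradient_comm hP j hs y
      rw [liftB_T_congr ih ht x]
      exact liftB_T_gradient_comm (hP.iterate_timeDerivWithin (uniqueDiffOn_Ici 0) j) ht x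

/-! ## The Leibniz rule for `∂ₜ` of the convective derivative -/

/-- `∂ₜ((a·∇)b) = ((∂ₜa)·∇)b + (a·∇)(∂ₜb)` for jointly smooth fields on `[0, ∞) × T³`. -/
theorem liftB_T_convect {a : ℝ → UnitAddTorus (Fin 3) → EuclideanSpace ℝ (Fin 3)} {b : ℝ → UnitAddTorus (Fin 3) → F}
    (ha : IsSmoothSpaceTimeOn (Ici 0) a) (hb : IsSmoothSpaceTimeOn (Ici 0) b)
    {t : ℝ} (ht : t ∈ Ici (0 : ℝ)) (x : UnitAddTorus (Fin 3)) :
    timeDerivWithin (Ici 0) (fun s => convect (a s) (b s)) t x =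
      convect (timeDerivWithin (Ici 0) a t) (b t) x +
        convect (a t) (timeDerivWithin (Ici 0) b t) x := by
  have hS := uniqueDiffOn_Ici (0 : ℝ)
  have e : ∀ s ∈ Ici (0 : ℝ), ∀ y : UnitAddTorus (Fin 3),
      (fun s => convect (a s) (b s)) s y = (fun s y => ∑ k, (a s y) k • partialDeriv k (b s) y) s y :=
    fun s hs y => fderiv_apply_eq_sum_partialDeriv ((hb.isSmooth_slice hs).isContDiff (by simp)) y _
  rw [liftB_T_congr e ht x,
    timeDerivWithin_finset_sum Finset.univ (fun k _ => (ha.apply k).smul (hb.partialDeriv hS k)) hS ht x]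
  have e1 : convect (timeDerivWithin (Ici 0) a t) (b t) x =
      ∑ k, (timeDerivWithin (Ici 0) a t x) k • partialDeriv k (b t) x :=
    fderiv_apply_eq_sum_partialDeriv ((hb.isSmooth_slice ht).isContDiff (by simp)) x _
  have e2 : convect (a t) (timeDerivWithin (Ici 0) b t) x =
      ∑ k, (a t x) k • partialDeriv k (timeDerivWithin (Ici 0) b t) x :=
    fderiv_apply_eq_sum_partialDeriv
      (((hb.timeDerivWithin hS).isSmooth_slice ht).isContDiff (by simp)) x _
  rw [e1, e2, ← Finset.sum_add_distrib]
  refine Finset.sum_congr rfl fun k _ => ?_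
  have hk : timeDerivWithin (Ici 0) (fun s y => (a s y) k) t x = (timeDerivWithin (Ici 0) a t x) k :=
    timeDerivWithin_clm_comp ha hS (EuclideanSpace.proj k) ht x
  rw [liftB_T_smul hS (ha.apply k) (hb.partialDeriv hS k) ht x, liftB_T_partialDeriv_comm hb ht k x,
    hk, add_comm]

/-! ## Incompressibility of time and word derivatives -/

/-- `∂ₜ` of a jointly smooth divergence-free field on `[0, ∞) × T³` is divergence free. -/
theorem liftB_T_isDivFree {U : ℝ → UnitAddTorus (Fin 3) → EuclideanSpace ℝ (Fin 3)} (hU : IsSmoothSpaceTimeOn (Ici 0) U)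
    (hdiv : ∀ s ∈ Ici (0 : ℝ), IsDivFree (U s)) {t : ℝ} (ht : t ∈ Ici (0 : ℝ)) :
    IsDivFree (timeDerivWithin (Ici 0) U t) := by
  intro x
  have hS := uniqueDiffOn_Ici (0 : ℝ)
  unfold divergence
  have e1 : ∀ i : Fin 3, partialDeriv i (fun y => timeDerivWithin (Ici 0) U t y i) x =
      timeDerivWithin (Ici 0) (fun s => partialDeriv i (fun y => U s y i)) t x := by
    intro i
    rw [liftB_T_partialDeriv_comm (hU.apply i) ht i x]
    congr 1
    funext y
    exact (timeDerivWithin_clm_comp hU hS (EuclideanSpace.proj i) ht y).symm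
  simp only [e1]
  rw [← timeDerivWithin_finset_sum Finset.univ (fun i _ => (hU.apply i).partialDeriv hS i) hS ht x]
  have e2 : ∀ s ∈ Ici (0 : ℝ), ∀ y : UnitAddTorus (Fin 3),
      (fun (τ : ℝ) (y : UnitAddTorus (Fin 3)) => ∑ i, partialDeriv i (fun z => U τ z i) y) s y =
        (fun (_ : ℝ) (_ : UnitAddTorus (Fin 3)) => (0 : ℝ)) s y :=
    fun s hs y => hdiv s hs y
  rw [liftB_T_congr e2 ht x]
  simp [timeDerivWithin]

/-- All `∂ₜʲ u` of a jointly smooth divergence-free field on `[0, ∞) × T³` are divergence free. -/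
theorem liftB_Titer_isDivFree {U : ℝ → UnitAddTorus (Fin 3) → EuclideanSpace ℝ (Fin 3)} (hU : IsSmoothSpaceTimeOn (Ici 0) U)
    (hdiv : ∀ s ∈ Ici (0 : ℝ), IsDivFree (U s)) :
    ∀ (j : ℕ) {t : ℝ}, t ∈ Ici (0 : ℝ) → IsDivFree ((timeDerivWithin (Ici 0))^[j] U t)
  | 0, _, ht => hdiv _ ht
  | j + 1, t, ht => by
      rw [iterate_succ_apply']
      exact liftB_T_isDivFree (hU.iterate_timeDerivWithin (uniqueDiffOn_Ici 0) j)
        (fun s hs => liftB_Titer_isDivFree hU hdiv j hs) ht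

/-- Word derivatives of a smooth divergence-free field are divergence free. -/
theorem liftB_isDivFree_wordDeriv {f : UnitAddTorus (Fin 3) → EuclideanSpace ℝ (Fin 3)} (hf : IsSmooth f) (hdiv : IsDivFree f) :
    ∀ w : List (Fin 3), IsDivFree (wordDeriv w f)
  | [] => hdiv
  | i :: w => by
      intro x
      rw [wordDeriv_cons, ← Literature.Analysis.FluidPDE.CompressibleEuler.partialDeriv_divergence_eq (isSmooth_wordDeriv hf w) i x]
      have h0 : divergence (wordDeriv w f) = fun _ => 0 :=
        funext (liftB_isDivFree_wordDeriv hf hdiv w)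
      rw [h0]
      simp [Torus.partialDeriv, Torus.lineDeriv]

/-! ## Word derivatives through sums and gradients -/

/-- `∂^w (∑ᵢ fᵢ) = ∑ᵢ ∂^w fᵢ` for smooth `fᵢ`. -/
theorem liftB_wordDeriv_finset_sum {ι : Type*} (s : Finset ι) {f : ι → UnitAddTorus (Fin 3) → F}
    (hf : ∀ i ∈ s, IsSmooth (f i)) :
    ∀ w : List (Fin 3), wordDeriv w (fun y => ∑ i ∈ s, f i y) = fun y => ∑ i ∈ s, wordDeriv w (f i) y
  | [] => rfl
  | j :: w => by
      rw [wordDeriv_cons, liftB_wordDeriv_finset_sum s hf w]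
      funext x
      rw [partialDeriv_finset_sum s
        (fun i hi => ((isSmooth_wordDeriv (hf i hi) w).isContDiff (by simp))) j x]
      rfl

/-- `∂^w ∇r = ∇ ∂^w r` for smooth scalar `r`. -/
theorem liftB_wordDeriv_gradient_comm {r : UnitAddTorus (Fin 3) → ℝ} (hr : IsSmooth r) :
    ∀ w : List (Fin 3), wordDeriv w (gradient r) = gradient (wordDeriv w r)
  | [] => rfl
  | j :: w => by
      rw [wordDeriv_cons, wordDeriv_cons, liftB_wordDeriv_gradient_comm hr w]
      funext x
      exact Literature.Analysis.FluidPDE.CompressibleEuler.partialDeriv_gradient_eq (isSmooth_wordDeriv hr w) j x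

/-! ## Anchor -/

/-- Part A, anchor (the registered helper signature): all iterated one-sided time derivatives
`∂ₜʲ U` of a jointly smooth divergence-free field on `[0, ∞) × T³` are divergence free. -/
theorem liftB_partA_anchor :
    ∀ (U : ℝ → UnitAddTorus (Fin 3) → EuclideanSpace ℝ (Fin 3)), IsSmoothSpaceTimeOn (Ici 0) U →
      (∀ s ∈ Ici (0 : ℝ), IsDivFree (U s)) →
      ∀ (j : ℕ) (t : ℝ), t ∈ Ici (0 : ℝ) → IsDivFree ((timeDerivWithin (Ici 0))^[j] U t) :=
  fun _ hU hdiv j _ ht => liftB_Titer_isDivFree hU hdiv j ht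

end Summit.AnomalousDissipation.AnomalousDissipation.Theorems.ChainRealisation.SeparatrixFluxPinning

end
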